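import Mathlib
import Literature.NumberTheory.LFunctions.Zhang2022.Section8LambdaZeroLocal
import HarnessLib

/-!
# Zhang (2022) §§8–10: crude arithmetic majorants for the `(d,r)`-sums of the `Sⱼ` evaluations
# (toolkit for the range-by-range steps of §10, DAG nodes `Z22:§10.u036–u038`, `u043–u044`, …)

Topic `Literature/NumberTheory/LFunctions/Zhang2022` (Landau–Siegel adjudication tree;
verdict-neutral). Y. Zhang, *Discrete mean estimates and the Landau–Siegel zero*,
arXiv:2211.02515v1 (2022) [Zhang2022LandauSiegel], §7 p. 33 (`λ(m,s)`, `λ₀ⱼ`), §8 Lemma 8.3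
(`Π(d,r)`), §8 p. 47–48 and §10 pp. 57–61: every evaluation of a sum
`Sⱼ(𝐚₁,𝐚₂) = Σ_dΣ_r |μ(r)|λ₀ⱼ(dr)(drφ(r))⁻¹(Σ_m …)(Σ_n …)` in the manuscript ("by Lemma 10.2 and
the results in Section 8, the sum over `P^a ≤ dr < P^b` is equal to … `+ o(α)`", p. 57) multiplies
two approximate evaluations and sums the products against the weights
`|χ(d)||μχ(r)|λ₀ⱼ(dr)/(drφ(r))` and the local factors `Π(d,r)`; the error terms are controlled by
crude majorants of these weights, which the manuscript leaves implicit. This file PROVES the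
majorants once (kernel-checked, elementary; no claim of the manuscript is involved):

* `norm_lamZero_le` — `|λ₀ⱼ(n)| ≤ (n/φ(n))⁴` (the shifts `β_k = ib_k` are purely imaginary, so every
  Euler factor of `λ(n, 1 − β_j)` has modulus between `1 − q⁻¹` and `1 + q⁻¹`);
* `norm_PiW_le` — `|Π(d,r)| ≤ (dr/φ(dr))²`;
* `sum_sqfree_divisors_inv_totient` — `Σ_{r∣n, r squarefree} φ(r)⁻¹ = n/φ(n)`;
* `ratio_pow_eq_sum_sqfree` / `sum_ratio_pow_div_le` — `(n/φ(n))^k = Σ_{d∣n, d sqfree} h_k(d)` with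
  `0 ≤ h_k(p) ≤ 2^{k+1}/p`, whence `Σ_{Y<n≤X} (n/φ(n))^k/n ≤ e^{2^{k+1}}(1 + log(X/Y))` (`Y ≥ 1`);
* `sum_sum_box_eq_sum_divisors` — the re-indexing `(d,r) ↦ (n = dr, r ∣ n)` of a `(d,r)`-box sum
  restricted to `dr` in a range.

No definitions of record, no named facts; nothing here bears on Theorems 1–2 of the source.

## References

* Y. Zhang, arXiv:2211.02515v1 (2022), §7 p. 33, §8 Lemma 8.3 and pp. 47–48, §10 pp. 57–61.
  [cite: Zhang2022LandauSiegel, §10 pp.57–61]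
* R. R. Hall, G. Tenenbaum, *Divisors*, CUP 1988, §0.2 (sums of sub-multiplicative functions).
  [cite: HallTenenbaum1988, §0.2]
-/

noncomputable section

open Complex Real Finset

namespace Literature.NumberTheory.LFunctions.Zhang2022.Skeleton

open Literature.NumberTheory.LFunctions.Zhang2022.Section8cProofs (betaJ_eq_real_mul_I beta1_eq
  beta2_eq beta3_eq)

/-! ## The ratio `n/φ(n)` as an Euler product -/

/-- `n/φ(n) = ∏_{q∣n} q/(q−1)` for `n ≠ 0` (Euler's product for `φ`). [cite: HallTenenbaum1988, §0.2] -/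
theorem self_div_totient_eq_prod {n : ℕ} (hn : n ≠ 0) :
    (n : ℝ) / Nat.totient n = ∏ q ∈ n.primeFactors, (q : ℝ) / (q - 1) := by
  have hφ : (Nat.totient n : ℝ) = n * ∏ q ∈ n.primeFactors, (1 - 1 / (q : ℝ)) :=
    totient_eq_mul_prod_real n
  have hn' : (n : ℝ) ≠ 0 := by exact_mod_cast hn
  rw [hφ, ← div_div, div_self hn', one_div, ← Finset.prod_inv_distrib]
  refine Finset.prod_congr rfl fun q hq => ?_
  have h2 : (2 : ℝ) ≤ q := by exact_mod_cast (Nat.prime_of_mem_primeFactors hq).two_le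
  have hq0 : (q : ℝ) ≠ 0 := by linarith
  have hq1 : (q : ℝ) - 1 ≠ 0 := by linarith
  field_simp

/-- `1 ≤ n/φ(n)` for `n ≠ 0`. [cite: HallTenenbaum1988, §0.2] -/
theorem one_le_self_div_totient {n : ℕ} (hn : n ≠ 0) : 1 ≤ (n : ℝ) / Nat.totient n := by
  have hφ : 0 < (Nat.totient n : ℝ) := by exact_mod_cast Nat.totient_pos.mpr (Nat.pos_of_ne_zero hn)
  rw [le_div_iff₀ hφ, one_mul]
  exact_mod_cast Nat.totient_le n

/-- A product of reals `≥ 0` over `s ⊆ t` is at most the product over `t` when the extra factors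
are `≥ 1`. [cite: HallTenenbaum1988, §0.2] -/
theorem prod_le_prod_of_subset_of_nonneg_of_one_le {ι : Type*} [DecidableEq ι] {s t : Finset ι}
    {f : ι → ℝ} (h : s ⊆ t) (h0 : ∀ i ∈ s, 0 ≤ f i) (h1 : ∀ i ∈ t, i ∉ s → 1 ≤ f i) :
    ∏ i ∈ s, f i ≤ ∏ i ∈ t, f i := by
  rw [← Finset.prod_sdiff h]
  have hge : 1 ≤ ∏ i ∈ t \ s, f i :=
    Finset.prod_induction _ (fun x => 1 ≤ x) (fun a b ha hb => one_le_mul_of_one_le_of_one_le ha hb)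
      le_rfl fun i hi => h1 i (Finset.mem_sdiff.mp hi).1 (Finset.mem_sdiff.mp hi).2
  exact le_mul_of_one_le_left (Finset.prod_nonneg h0) hge

/-- A sub-product of the factors `q/(q−1) ≥ 1` is at most the full product `n/φ(n)`. [cite: HallTenenbaum1988, §0.2] -/
theorem prod_filter_div_sub_one_le {n : ℕ} (hn : n ≠ 0) (p : ℕ → Prop) [DecidablePred p] :
    ∏ q ∈ n.primeFactors.filter p, (q : ℝ) / (q - 1) ≤ (n : ℝ) / Nat.totient n := by
  classical
  rw [self_div_totient_eq_prod hn]
  refine prod_le_prod_of_subset_of_nonneg_of_one_le (Finset.filter_subset _ _) (fun q hq => ?_)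
    fun q hq _ => ?_
  · have h2 : (2 : ℝ) ≤ q := by
      exact_mod_cast (Nat.prime_of_mem_primeFactors (Finset.mem_of_mem_filter q hq)).two_le
    exact div_nonneg (by linarith) (by linarith)
  · have h2 : (2 : ℝ) ≤ q := by exact_mod_cast (Nat.prime_of_mem_primeFactors hq).two_le
    rw [le_div_iff₀ (by linarith)]; linarith

/-! ## `|λ₀ⱼ(n)| ≤ (n/φ(n))⁴` -/

/-- For a natural `q ≥ 1` and real `θ`: `‖(q : ℂ)^{-(1 + iθ)}‖ = q⁻¹`. [cite: Zhang2022LandauSiegel, §7 p. 33] -/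
theorem norm_natCast_cpow_neg_one_add_mul_I {q : ℕ} (hq : 0 < q) (θ : ℝ) :
    ‖(q : ℂ) ^ (-(1 + (θ : ℂ) * I))‖ = (q : ℝ)⁻¹ := by
  rw [Complex.norm_natCast_cpow_of_pos hq]
  simp [Real.rpow_neg_one]

/-- One Euler factor of `λ(n, 1 − β_j)`: for a prime `q` and real `b₀, b₁, b₂, b₃`,
`‖(1 − q^{−(1+i(b₁−b₀))})(1 − q^{−(1+i(b₂−b₀))})(1 − q^{−(1+i(b₃−b₀))})/(1 − q^{−(1−ib₀)})‖ ≤ (q/(q−1))⁴`.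
[cite: Zhang2022LandauSiegel, §7 p. 33] -/
theorem norm_lam_factor_le {q : ℕ} (hq : q.Prime) (s β₁ β₂ β₃ : ℂ) (hs : s.re = 1)
    (h₁ : β₁.re = 0) (h₂ : β₂.re = 0) (h₃ : β₃.re = 0) :
    ‖(1 - (q : ℂ) ^ (-(s + β₁))) * (1 - (q : ℂ) ^ (-(s + β₂))) * (1 - (q : ℂ) ^ (-(s + β₃))) /
        (1 - (q : ℂ) ^ (-s))‖ ≤ ((q : ℝ) / (q - 1)) ^ 4 := by
  have hq0 : 0 < q := hq.pos
  have hq2 : (2 : ℝ) ≤ q := by exact_mod_cast hq.two_le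
  have hqr : (0 : ℝ) < q := by exact_mod_cast hq0
  -- every `q^{-w}` with `Re w = 1` has norm `q⁻¹`
  have hnorm : ∀ w : ℂ, w.re = 1 → ‖(q : ℂ) ^ (-w)‖ = (q : ℝ)⁻¹ := by
    intro w hw
    rw [Complex.norm_natCast_cpow_of_pos hq0]
    simp [hw, Real.rpow_neg_one]
  have n1 : ‖(q : ℂ) ^ (-(s + β₁))‖ = (q : ℝ)⁻¹ := hnorm _ (by simp [hs, h₁])
  have n2 : ‖(q : ℂ) ^ (-(s + β₂))‖ = (q : ℝ)⁻¹ := hnorm _ (by simp [hs, h₂])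
  have n3 : ‖(q : ℂ) ^ (-(s + β₃))‖ = (q : ℝ)⁻¹ := hnorm _ (by simp [hs, h₃])
  have n0 : ‖(q : ℂ) ^ (-s)‖ = (q : ℝ)⁻¹ := hnorm _ hs
  -- numerators `≤ 1 + q⁻¹`, denominator `≥ 1 − q⁻¹`
  have hup : ∀ {z : ℂ}, ‖z‖ = (q : ℝ)⁻¹ → ‖1 - z‖ ≤ 1 + (q : ℝ)⁻¹ := by
    intro z hz
    calc ‖1 - z‖ ≤ ‖(1 : ℂ)‖ + ‖z‖ := norm_sub_le _ _
      _ = 1 + (q : ℝ)⁻¹ := by rw [norm_one, hz]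
  have hdown : 1 - (q : ℝ)⁻¹ ≤ ‖1 - (q : ℂ) ^ (-s)‖ := by
    have := norm_sub_norm_le (1 : ℂ) ((q : ℂ) ^ (-s))
    rw [norm_one, n0] at this
    linarith
  have hpos : 0 < 1 - (q : ℝ)⁻¹ := by
    rw [sub_pos, inv_lt_one_iff₀]; right; linarith
  have hden_pos : 0 < ‖1 - (q : ℂ) ^ (-s)‖ := lt_of_lt_of_le hpos hdown
  rw [norm_div, norm_mul, norm_mul, div_le_iff₀ hden_pos]
  -- `(1 + q⁻¹)³ ≤ (q/(q−1))⁴ (1 − q⁻¹)` since `1 + q⁻¹ ≤ q/(q−1)` and `(q/(q−1))(1 − q⁻¹) = 1`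
  have hratio : 1 + (q : ℝ)⁻¹ ≤ (q : ℝ) / (q - 1) := by
    rw [le_div_iff₀ (by linarith)]
    have : (1 + (q : ℝ)⁻¹) * (q - 1) = q - (q : ℝ)⁻¹ := by field_simp; ring
    rw [this]
    have : 0 < (q : ℝ)⁻¹ := by positivity
    linarith
  have hkey : ((q : ℝ) / (q - 1)) ^ 4 * (1 - (q : ℝ)⁻¹) = ((q : ℝ) / (q - 1)) ^ 3 := by
    have hq1 : (q : ℝ) - 1 ≠ 0 := by linarith
    have hq0' : (q : ℝ) ≠ 0 := by linarith
    rw [show (1 : ℝ) - (q : ℝ)⁻¹ = (q - 1) / q by field_simp]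
    field_simp
  have h0 : 0 ≤ 1 + (q : ℝ)⁻¹ := by positivity
  have hr0 : 0 ≤ (q : ℝ) / (q - 1) := le_trans h0 hratio
  have A := hup n1
  have B := hup n2
  have C := hup n3
  calc ‖1 - (q : ℂ) ^ (-(s + β₁))‖ * ‖1 - (q : ℂ) ^ (-(s + β₂))‖ * ‖1 - (q : ℂ) ^ (-(s + β₃))‖
      ≤ (1 + (q : ℝ)⁻¹) * (1 + (q : ℝ)⁻¹) * (1 + (q : ℝ)⁻¹) :=
        mul_le_mul (mul_le_mul A B (norm_nonneg _) h0) C (norm_nonneg _) (mul_nonneg h0 h0)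
    _ ≤ (q : ℝ) / (q - 1) * ((q : ℝ) / (q - 1)) * ((q : ℝ) / (q - 1)) :=
        mul_le_mul (mul_le_mul hratio hratio h0 hr0) hratio h0 (mul_nonneg hr0 hr0)
    _ = ((q : ℝ) / (q - 1)) ^ 3 := by ring
    _ = ((q : ℝ) / (q - 1)) ^ 4 * (1 - (q : ℝ)⁻¹) := hkey.symm
    _ ≤ ((q : ℝ) / (q - 1)) ^ 4 * ‖1 - (q : ℂ) ^ (-s)‖ := by gcongr

/-- **`|λ₀ⱼ(n)| ≤ (n/φ(n))⁴`** for `n ≠ 0` (any `c′`, `D`, `j`): `λ₀ⱼ(n) = λ(n, 1 − β_j)` (§7 p. 33)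
is a product over `q ∣ n` of factors of modulus `≤ (q/(q−1))⁴` (`norm_lam_factor_le`; the shifts
`β_k = ib_k` of (2.13) are purely imaginary). [cite: Zhang2022LandauSiegel, §7 p. 33] -/
theorem norm_lamZero_le (c' : ℝ) (D j : ℕ) {n : ℕ} (hn : n ≠ 0) :
    ‖lamZero c' D j n‖ ≤ ((n : ℝ) / Nat.totient n) ^ 4 := by
  obtain ⟨b, hb, -⟩ := betaJ_eq_real_mul_I c' D j
  rw [lamZero, lam, self_div_totient_eq_prod hn, ← Finset.prod_pow]
  refine (Finset.norm_prod_le _ _).trans (Finset.prod_le_prod (fun q _ => norm_nonneg _) fun q hq => ?_)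
  have hqp := Nat.prime_of_mem_primeFactors hq
  refine norm_lam_factor_le hqp _ _ _ _ ?_ ?_ ?_ ?_
  · simp [hb]
  · rw [beta1_eq]; simp
  · rw [beta2_eq]; simp
  · rw [beta3_eq]; simp

/-! ## `|Π(d,r)| ≤ (dr/φ(dr))²` -/

/-- **`|Π(d,r)| ≤ (dr/φ(dr))²`** for `d, r ≠ 0` and any Dirichlet character (`|χ(q)| ≤ 1`): the
first product of Lemma 8.3's `Π(d,r)` has factors `|1 − χ(q)q⁻¹|⁻¹ ≤ q/(q−1)`, the second
`|1 − q⁻¹ − χ(q)q⁻¹|/(1 − q⁻¹) ≤ q/(q−1)`. [cite: Zhang2022LandauSiegel, §8 Lemma 8.3] -/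
theorem norm_PiW_le {D : ℕ} (χ : DirichletCharacter ℂ D) {d r : ℕ} (hd : d ≠ 0) (hr : r ≠ 0) :
    ‖PiW χ d r‖ ≤ ((((d * r : ℕ) : ℝ)) / Nat.totient (d * r)) ^ 2 := by
  classical
  have hdr : d * r ≠ 0 := mul_ne_zero hd hr
  have fac : ∀ q ∈ (d * r).primeFactors, (2 : ℝ) ≤ q := fun q hq => by
    exact_mod_cast (Nat.prime_of_mem_primeFactors hq).two_le
  rw [PiW, norm_mul, pow_two]
  refine mul_le_mul ?_ ?_ (norm_nonneg _) (le_trans zero_le_one (one_le_self_div_totient hdr))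
  · -- first product
    rw [self_div_totient_eq_prod hdr]
    refine (Finset.norm_prod_le _ _).trans (Finset.prod_le_prod (fun q _ => norm_nonneg _) fun q hq => ?_)
    have h2 := fac q hq
    have hχ : ‖χ (q : ZMod D)‖ ≤ 1 := DirichletCharacter.norm_le_one χ _
    have hz : ‖χ (q : ZMod D) * (q : ℂ)⁻¹‖ ≤ (q : ℝ)⁻¹ := by
      rw [norm_mul, norm_inv, Complex.norm_natCast]
      calc ‖χ (q : ZMod D)‖ * (q : ℝ)⁻¹ ≤ 1 * (q : ℝ)⁻¹ := by gcongr
        _ = (q : ℝ)⁻¹ := one_mul _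
    have hlow : 1 - (q : ℝ)⁻¹ ≤ ‖1 - χ (q : ZMod D) * (q : ℂ)⁻¹‖ := by
      have := norm_sub_norm_le (1 : ℂ) (χ (q : ZMod D) * (q : ℂ)⁻¹)
      rw [norm_one] at this
      linarith
    have hpos : 0 < 1 - (q : ℝ)⁻¹ := by
      rw [sub_pos, inv_lt_one_iff₀]; right; linarith
    have hqpos : 0 < (q : ℝ) / (q - 1) := div_pos (by linarith) (by linarith)
    rw [norm_inv, inv_le_comm₀ (lt_of_lt_of_le hpos hlow) hqpos]
    calc ((q : ℝ) / (q - 1))⁻¹ = 1 - (q : ℝ)⁻¹ := by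
          have : (q : ℝ) - 1 ≠ 0 := by linarith
          field_simp
      _ ≤ _ := hlow
  · -- second product
    have hP := prod_filter_div_sub_one_le hdr (fun q => q ∈ d.primeFactors ∧ Nat.Coprime q r)
    refine le_trans ?_ hP
    have hsub : d.primeFactors.filter (fun q => Nat.Coprime q r) ⊆
        (d * r).primeFactors.filter (fun q => q ∈ d.primeFactors ∧ Nat.Coprime q r) := by
      intro q hq
      rw [Finset.mem_filter] at hq ⊢
      exact ⟨Nat.mem_primeFactors.mpr ⟨Nat.prime_of_mem_primeFactors hq.1,
        dvd_mul_of_dvd_left (Nat.dvd_of_mem_primeFactors hq.1) r, hdr⟩, hq.1, hq.2⟩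
    have hge2 : ∀ q ∈ (d * r).primeFactors.filter (fun q => q ∈ d.primeFactors ∧ Nat.Coprime q r),
        (2 : ℝ) ≤ q := fun q hq => fac q (Finset.mem_filter.mp hq).1
    -- termwise `‖(1 − q⁻¹ − χ(q)q⁻¹)/(1 − q⁻¹)‖ ≤ q/(q−1)` on the small set
    have hterm : ∀ q ∈ d.primeFactors.filter (fun q => Nat.Coprime q r),
        ‖(1 - (q : ℂ)⁻¹ - χ (q : ZMod D) * (q : ℂ)⁻¹) / (1 - (q : ℂ)⁻¹)‖ ≤ (q : ℝ) / (q - 1) := by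
      intro q hq
      have h2 := hge2 q (hsub hq)
      have hχ : ‖χ (q : ZMod D)‖ ≤ 1 := DirichletCharacter.norm_le_one χ _
      have hq1 : (0 : ℝ) < q - 1 := by linarith
      have hq0 : (q : ℝ) ≠ 0 := by linarith
      have hden : ‖(1 : ℂ) - (q : ℂ)⁻¹‖ = 1 - (q : ℝ)⁻¹ := by
        have : (1 : ℂ) - (q : ℂ)⁻¹ = ((1 - (q : ℝ)⁻¹ : ℝ) : ℂ) := by push_cast; ring
        rw [this, Complex.norm_real, Real.norm_of_nonneg]
        rw [sub_nonneg, inv_le_one_iff₀]; right; linarith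
      have hpos : 0 < 1 - (q : ℝ)⁻¹ := by
        rw [sub_pos, inv_lt_one_iff₀]; right; linarith
      have hnum : ‖1 - (q : ℂ)⁻¹ - χ (q : ZMod D) * (q : ℂ)⁻¹‖ ≤ 1 := by
        calc ‖1 - (q : ℂ)⁻¹ - χ (q : ZMod D) * (q : ℂ)⁻¹‖
            ≤ ‖(1 : ℂ) - (q : ℂ)⁻¹‖ + ‖χ (q : ZMod D) * (q : ℂ)⁻¹‖ := norm_sub_le _ _
          _ ≤ (1 - (q : ℝ)⁻¹) + 1 * (q : ℝ)⁻¹ := by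
              rw [hden, norm_mul, norm_inv, Complex.norm_natCast]
              gcongr
          _ = 1 := by ring
      rw [norm_div, hden, div_le_div_iff₀ hpos hq1]
      calc ‖1 - (q : ℂ)⁻¹ - χ (q : ZMod D) * (q : ℂ)⁻¹‖ * ((q : ℝ) - 1) ≤ 1 * ((q : ℝ) - 1) := by
            gcongr
        _ = q * (1 - (q : ℝ)⁻¹) := by field_simp
    calc ‖∏ q ∈ d.primeFactors.filter (fun q => Nat.Coprime q r),
            (1 - (q : ℂ)⁻¹ - χ (q : ZMod D) * (q : ℂ)⁻¹) / (1 - (q : ℂ)⁻¹)‖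
        ≤ ∏ q ∈ d.primeFactors.filter (fun q => Nat.Coprime q r),
            ‖(1 - (q : ℂ)⁻¹ - χ (q : ZMod D) * (q : ℂ)⁻¹) / (1 - (q : ℂ)⁻¹)‖ := Finset.norm_prod_le _ _
      _ ≤ ∏ q ∈ d.primeFactors.filter (fun q => Nat.Coprime q r), (q : ℝ) / (q - 1) :=
          Finset.prod_le_prod (fun q _ => norm_nonneg _) hterm
      _ ≤ ∏ q ∈ (d * r).primeFactors.filter (fun q => q ∈ d.primeFactors ∧ Nat.Coprime q r),
            (q : ℝ) / (q - 1) := by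
          refine prod_le_prod_of_subset_of_nonneg_of_one_le hsub (fun q hq => ?_) fun q hq _ => ?_
          · have h2 := hge2 q (hsub hq)
            exact div_nonneg (by linarith) (by linarith)
          · have h2 := hge2 q hq
            rw [le_div_iff₀ (by linarith)]; linarith

/-! ## `Σ_{r ∣ n squarefree} 1/φ(r) = n/φ(n)` -/

/-- `φ(∏_{q∈t} q) = ∏_{q∈t}(q − 1)` for a finite set `t` of primes. [cite: HallTenenbaum1988, §0.2] -/
theorem totient_prod_primes (t : Finset ℕ) (ht : ∀ q ∈ t, q.Prime) :
    Nat.totient (∏ q ∈ t, q) = ∏ q ∈ t, (q - 1) := by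
  classical
  induction t using Finset.induction_on with
  | empty => simp
  | insert a s has ih =>
    have ha : a.Prime := ht a (Finset.mem_insert_self a s)
    have hs : ∀ q ∈ s, q.Prime := fun q hq => ht q (Finset.mem_insert_of_mem hq)
    rw [Finset.prod_insert has, Finset.prod_insert has]
    have hcop : Nat.Coprime a (∏ q ∈ s, q) := by
      refine Nat.Coprime.prod_right fun q hq => ?_
      have hne : a ≠ q := fun h => has (h ▸ hq)
      exact (Nat.coprime_primes ha (hs q hq)).mpr hne
    rw [Nat.totient_mul hcop, ih hs, Nat.totient_prime ha]

/-- **`Σ_{r∣n, r squarefree} φ(r)⁻¹ = n/φ(n)`** (`n ≠ 0`): both sides are `∏_{q∣n}(1 + (q−1)⁻¹)`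
(the weight identity paired with (8.10) in the `n = dr` substitution). [cite: Zhang2022LandauSiegel, §8 (8.10) p. 48] -/
theorem sum_sqfree_divisors_inv_totient {n : ℕ} (hn : n ≠ 0) :
    ∑ r ∈ n.divisors with Squarefree r, (1 / (Nat.totient r : ℝ)) = (n : ℝ) / Nat.totient n := by
  classical
  have key : ∑ r ∈ n.divisors with Squarefree r, (1 / (Nat.totient r : ℝ)) =
      ∏ q ∈ n.primeFactors, (1 + 1 / ((q : ℝ) - 1)) := by
    rw [Finset.prod_one_add, Nat.sum_divisors_filter_squarefree hn]
    have hPF : (UniqueFactorizationMonoid.normalizedFactors n).toFinset = n.primeFactors := by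
      rw [Nat.factors_eq]; rfl
    rw [hPF]
    refine Finset.sum_congr rfl (fun t ht => ?_)
    rw [Finset.mem_powerset] at ht
    have hprime : ∀ q ∈ t, q.Prime := fun q hq => Nat.prime_of_mem_primeFactors (ht hq)
    have hval : t.val.prod = ∏ q ∈ t, q := by rw [Finset.prod_val]; rfl
    rw [hval, totient_prod_primes t hprime, Nat.cast_prod, one_div, ← Finset.prod_inv_distrib]
    refine Finset.prod_congr rfl fun q hq => ?_
    have h1 : 1 ≤ q := (hprime q hq).one_le
    rw [Nat.cast_sub h1, Nat.cast_one, one_div]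
  rw [key, self_div_totient_eq_prod hn]
  refine Finset.prod_congr rfl fun q hq => ?_
  have h2 : (2 : ℝ) ≤ q := by exact_mod_cast (Nat.prime_of_mem_primeFactors hq).two_le
  have : (q : ℝ) - 1 ≠ 0 := by linarith
  field_simp
  ring

/-! ## Harmonic windows -/

/-- `Σ_{A<j≤B} 1/j ≤ 1 + log B − log(A+1)` (from Mathlib's harmonic-number bounds). [cite: HallTenenbaum1988, §0.2] -/
theorem sum_Ioc_inv_le_log {A B : ℕ} (hAB : A ≤ B) :
    ∑ j ∈ Finset.Ioc A B, (1 / (j : ℝ)) ≤ 1 + Real.log B - Real.log (A + 1) := by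
  have h1 : ∑ j ∈ Finset.Ioc A B, (1 / (j : ℝ)) = (harmonic B : ℝ) - (harmonic A : ℝ) := by
    rw [harmonic_eq_sum_Icc, harmonic_eq_sum_Icc]
    push_cast
    have hU : Finset.Icc 1 B = Finset.Icc 1 A ∪ Finset.Ioc A B := by
      ext j; simp only [Finset.mem_union, Finset.mem_Icc, Finset.mem_Ioc]; omega
    have hD : Disjoint (Finset.Icc 1 A) (Finset.Ioc A B) := by
      rw [Finset.disjoint_left]
      intro j h1 h2
      simp only [Finset.mem_Icc, Finset.mem_Ioc] at h1 h2
      omega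
    rw [hU, Finset.sum_union hD]
    simp only [one_div]
    ring
  rw [h1]
  have hB := harmonic_le_one_add_log B
  have hA := log_add_one_le_harmonic A
  push_cast at hA
  linarith

/-- The window harmonic sum over the multiples of `m`:
`Σ_{Y<n≤X, m∣n} 1/n ≤ m⁻¹(1 + log X − log Y)` (`1 ≤ Y ≤ X`, `m ≥ 1`). [cite: HallTenenbaum1988, §0.2] -/
theorem sum_Ioc_filter_dvd_inv_le {m Y X : ℕ} (hm : 0 < m) (hY : 0 < Y) (hYX : Y ≤ X) :
    ∑ n ∈ (Finset.Ioc Y X).filter (fun n => m ∣ n), (1 / (n : ℝ)) ≤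
      (1 / (m : ℝ)) * (1 + Real.log X - Real.log Y) := by
  classical
  have hset : (Finset.Ioc Y X).filter (fun n => m ∣ n) =
      (Finset.Ioc (Y / m) (X / m)).image (fun j => m * j) := by
    ext n
    simp only [Finset.mem_filter, Finset.mem_Ioc, Finset.mem_image]
    constructor
    · rintro ⟨⟨h1, h2⟩, ⟨j, rfl⟩⟩
      refine ⟨j, ⟨?_, ?_⟩, rfl⟩
      · exact Nat.div_lt_of_lt_mul h1
      · exact (Nat.le_div_iff_mul_le hm).mpr (by rw [mul_comm]; exact h2)
    · rintro ⟨j, ⟨h1, h2⟩, rfl⟩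
      refine ⟨⟨?_, ?_⟩, dvd_mul_right m j⟩
      · have := (Nat.div_lt_iff_lt_mul hm).mp h1
        rw [mul_comm]; exact this
      · have := (Nat.le_div_iff_mul_le hm).mp h2
        rw [mul_comm]; exact this
  rw [hset, Finset.sum_image (fun a _ b _ h => Nat.eq_of_mul_eq_mul_left hm h)]
  have hm0 : (m : ℝ) ≠ 0 := by exact_mod_cast hm.ne'
  have hsplit : ∑ j ∈ Finset.Ioc (Y / m) (X / m), (1 / ((m * j : ℕ) : ℝ)) =
      (1 / (m : ℝ)) * ∑ j ∈ Finset.Ioc (Y / m) (X / m), (1 / (j : ℝ)) := by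
    rw [Finset.mul_sum]
    refine Finset.sum_congr rfl fun j _ => ?_
    push_cast
    rw [one_div_mul_one_div]
  rw [hsplit]
  refine mul_le_mul_of_nonneg_left ?_ (by positivity)
  refine (sum_Ioc_inv_le_log (Nat.div_le_div_right hYX)).trans ?_
  -- `log ⌊X/m⌋ − log(⌊Y/m⌋ + 1) ≤ log X − log Y`
  have hYr : (0 : ℝ) < Y := by exact_mod_cast hY
  have hXr : (0 : ℝ) < X := by exact_mod_cast lt_of_lt_of_le hY hYX
  have hmr : (0 : ℝ) < m := by exact_mod_cast hm
  have hA : Real.log Y - Real.log m ≤ Real.log (((Y / m : ℕ) : ℝ) + 1) := by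
    rw [← Real.log_div hYr.ne' hmr.ne']
    refine Real.log_le_log (div_pos hYr hmr) ?_
    have := Nat.lt_div_mul_add (a := Y) hm
    have h' : (Y : ℝ) < (m : ℝ) * ((Y / m : ℕ) : ℝ) + m := by exact_mod_cast (by linarith [this])
    rw [div_le_iff₀ hmr]
    nlinarith
  rcases Nat.eq_zero_or_pos (X / m) with h0 | hpos
  · rw [h0, Nat.cast_zero, Real.log_zero]
    have hlogXY : Real.log Y ≤ Real.log X := Real.log_le_log hYr (by exact_mod_cast hYX)
    have hA0 : 0 ≤ Real.log (((Y / m : ℕ) : ℝ) + 1) := Real.log_nonneg (by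
      have : (0 : ℝ) ≤ ((Y / m : ℕ) : ℝ) := Nat.cast_nonneg _
      linarith)
    linarith
  · have hB : Real.log ((X / m : ℕ) : ℝ) ≤ Real.log X - Real.log m := by
      rw [← Real.log_div hXr.ne' hmr.ne']
      refine Real.log_le_log (by exact_mod_cast hpos) ?_
      exact Nat.cast_div_le
    linarith

/-! ## The weights `(n/φ(n))^k`: an Euler-product majorant without divisor-function losses -/

/-- `(1 + t)^k ≤ 1 + (2^k − 1)t` for `0 ≤ t ≤ 1` (convexity). [cite: HallTenenbaum1988, §0.2] -/
theorem one_add_pow_le_of_le_one (k : ℕ) {t : ℝ} (h0 : 0 ≤ t) (h1 : t ≤ 1) :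
    (1 + t) ^ k ≤ 1 + (2 ^ k - 1) * t := by
  induction k with
  | zero => simp
  | succ k ih =>
    have h2k : (1 : ℝ) ≤ 2 ^ k := one_le_pow₀ (by norm_num)
    have htt : t * t ≤ t := by nlinarith
    have h2k' : (0 : ℝ) ≤ 2 ^ k - 1 := by linarith
    calc (1 + t) ^ (k + 1) = (1 + t) * (1 + t) ^ k := by ring
      _ ≤ (1 + t) * (1 + (2 ^ k - 1) * t) := by gcongr
      _ = 1 + (2 ^ k - 1) * t + t + (2 ^ k - 1) * (t * t) := by ring
      _ ≤ 1 + (2 ^ k - 1) * t + t + (2 ^ k - 1) * t := by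
          nlinarith [mul_le_mul_of_nonneg_left htt h2k']
      _ = 1 + (2 ^ (k + 1) - 1) * t := by ring

/-- The local excess `a_k(q) = (q/(q−1))^k − 1` of the weight `(n/φ(n))^k` at a prime `q ≥ 2`:
`0 ≤ a_k(q) ≤ 2^{k+1}/q`. [cite: HallTenenbaum1988, §0.2] -/
theorem ratio_pow_sub_one_bounds (k : ℕ) {q : ℕ} (hq : 2 ≤ q) :
    0 ≤ ((q : ℝ) / (q - 1)) ^ k - 1 ∧ ((q : ℝ) / (q - 1)) ^ k - 1 ≤ 2 ^ (k + 1) / q := by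
  have hq2 : (2 : ℝ) ≤ q := by exact_mod_cast hq
  have hq1 : (0 : ℝ) < q - 1 := by linarith
  have ht : (q : ℝ) / (q - 1) = 1 + 1 / (q - 1) := by field_simp; ring
  have h01 : 0 ≤ 1 / ((q : ℝ) - 1) := by positivity
  have h11 : 1 / ((q : ℝ) - 1) ≤ 1 := by rw [div_le_one hq1]; linarith
  refine ⟨?_, ?_⟩
  · rw [ht, sub_nonneg]
    exact one_le_pow₀ (by linarith)
  · rw [ht]
    have h := one_add_pow_le_of_le_one k h01 h11
    have h2k : (0 : ℝ) ≤ 2 ^ k - 1 := by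
      have : (1 : ℝ) ≤ 2 ^ k := one_le_pow₀ (by norm_num)
      linarith
    -- `(2^k − 1)/(q − 1) ≤ 2^{k+1}/q` since `q ≤ 2(q−1)`
    have hq0 : (0 : ℝ) < q := by linarith
    have key : (2 ^ k - 1) * (1 / ((q : ℝ) - 1)) ≤ 2 ^ (k + 1) / q := by
      rw [mul_one_div, div_le_div_iff₀ hq1 hq0, pow_succ]
      nlinarith
    linarith

/-- **`(n/φ(n))^k = Σ_{t ⊆ {q ∣ n}} ∏_{q∈t} a_k(q)`** (`n ≠ 0`), the expansion of
`∏_{q∣n}(1 + a_k(q))`. [cite: HallTenenbaum1988, §0.2] -/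
theorem ratio_pow_eq_sum_powerset (k : ℕ) {n : ℕ} (hn : n ≠ 0) :
    ((n : ℝ) / Nat.totient n) ^ k =
      ∑ t ∈ n.primeFactors.powerset, ∏ q ∈ t, (((q : ℝ) / (q - 1)) ^ k - 1) := by
  rw [self_div_totient_eq_prod hn, ← Finset.prod_pow, ← Finset.prod_one_add]
  refine Finset.prod_congr rfl fun q _ => by ring

/-- **Crude weighted harmonic window**: for `k ∈ ℕ` and `1 ≤ Y ≤ X`,
`Σ_{Y<n≤X} (n/φ(n))^k/n ≤ e^{2^{k+1}}·(1 + log X − log Y)` — no divisor-function loss (the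
expansion `(n/φ(n))^k = Σ_{t⊆{q∣n}}∏a_k(q)`, the swap of summations, the window harmonic sum over
multiples of `∏_{q∈t}q`, and `∏_{q≤X}(1 + a_k(q)/q) ≤ exp(2^{k+1}Σq⁻²) ≤ e^{2^{k+1}}`).
[cite: HallTenenbaum1988, §0.2] -/
theorem sum_ratio_pow_div_le (k : ℕ) {Y X : ℕ} (hY : 0 < Y) (hYX : Y ≤ X) :
    ∑ n ∈ Finset.Ioc Y X, ((n : ℝ) / Nat.totient n) ^ k / n ≤
      Real.exp (2 ^ (k + 1)) * (1 + Real.log X - Real.log Y) := by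
  classical
  set a : ℕ → ℝ := fun q => ((q : ℝ) / (q - 1)) ^ k - 1 with ha
  set L : ℝ := 1 + Real.log X - Real.log Y with hL
  set PB : Finset ℕ := (Finset.Icc 1 X).filter Nat.Prime with hPB
  have hL0 : 0 ≤ L := by
    have : Real.log Y ≤ Real.log X :=
      Real.log_le_log (by exact_mod_cast hY) (by exact_mod_cast hYX)
    rw [hL]; linarith
  have ha0 : ∀ q, q.Prime → 0 ≤ a q := fun q hq => (ratio_pow_sub_one_bounds k hq.two_le).1
  -- (1) expand and swap
  have step1 : ∑ n ∈ Finset.Ioc Y X, ((n : ℝ) / Nat.totient n) ^ k / n =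
      ∑ n ∈ Finset.Ioc Y X, ∑ t ∈ n.primeFactors.powerset, (∏ q ∈ t, a q) / n := by
    refine Finset.sum_congr rfl fun n hn => ?_
    have hn0 : n ≠ 0 := by
      have := (Finset.mem_Ioc.mp hn).1; omega
    rw [ratio_pow_eq_sum_powerset k hn0, Finset.sum_div]
  have step2 : ∑ n ∈ Finset.Ioc Y X, ∑ t ∈ n.primeFactors.powerset, (∏ q ∈ t, a q) / n =
      ∑ t ∈ PB.powerset, ∑ n ∈ (Finset.Ioc Y X).filter (fun n => t ⊆ n.primeFactors),
        (∏ q ∈ t, a q) / n := by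
    refine Finset.sum_comm' fun n t => ?_
    simp only [Finset.mem_powerset, Finset.mem_filter, Finset.mem_Ioc]
    constructor
    · rintro ⟨hn, ht⟩
      refine ⟨⟨hn, ht⟩, ?_⟩
      intro q hq
      have hq' := ht hq
      rw [hPB, Finset.mem_filter, Finset.mem_Icc]
      have hqp := Nat.prime_of_mem_primeFactors hq'
      have hn0 : n ≠ 0 := by omega
      exact ⟨⟨hqp.one_le, le_trans (Nat.le_of_dvd (Nat.pos_of_ne_zero hn0)
        (Nat.dvd_of_mem_primeFactors hq')) hn.2⟩, hqp⟩
    · rintro ⟨⟨hn, ht⟩, -⟩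
      exact ⟨hn, ht⟩
  -- (2) the inner sums
  have inner : ∀ t ∈ PB.powerset,
      ∑ n ∈ (Finset.Ioc Y X).filter (fun n => t ⊆ n.primeFactors), (∏ q ∈ t, a q) / n ≤
        (∏ q ∈ t, a q / q) * L := by
    intro t ht
    rw [Finset.mem_powerset] at ht
    have htp : ∀ q ∈ t, q.Prime := fun q hq => (Finset.mem_filter.mp (ht hq)).2
    have hprod0 : 0 ≤ ∏ q ∈ t, a q := Finset.prod_nonneg fun q hq => ha0 q (htp q hq)
    set m : ℕ := ∏ q ∈ t, q with hm
    have hm0 : 0 < m := Finset.prod_pos fun q hq => (htp q hq).pos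
    -- `t ⊆ pf(n)` implies `m ∣ n`
    have hsub : (Finset.Ioc Y X).filter (fun n => t ⊆ n.primeFactors) ⊆
        (Finset.Ioc Y X).filter (fun n => m ∣ n) := by
      intro n hn
      rw [Finset.mem_filter] at hn ⊢
      refine ⟨hn.1, ?_⟩
      exact (Finset.prod_dvd_prod_of_subset _ _ (fun q => q) hn.2).trans
        (Nat.prod_primeFactors_dvd n)
    calc ∑ n ∈ (Finset.Ioc Y X).filter (fun n => t ⊆ n.primeFactors), (∏ q ∈ t, a q) / n
        ≤ ∑ n ∈ (Finset.Ioc Y X).filter (fun n => m ∣ n), (∏ q ∈ t, a q) / n :=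
          Finset.sum_le_sum_of_subset_of_nonneg hsub fun n _ _ => by positivity
      _ = (∏ q ∈ t, a q) * ∑ n ∈ (Finset.Ioc Y X).filter (fun n => m ∣ n), (1 / (n : ℝ)) := by
          rw [Finset.mul_sum]
          refine Finset.sum_congr rfl fun n _ => by rw [mul_one_div]
      _ ≤ (∏ q ∈ t, a q) * ((1 / (m : ℝ)) * L) :=
          mul_le_mul_of_nonneg_left (sum_Ioc_filter_dvd_inv_le hm0 hY hYX) hprod0
      _ = (∏ q ∈ t, a q / q) * L := by
          rw [hm, Nat.cast_prod, Finset.prod_div_distrib]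
          ring
  -- (3) the Euler product
  have step3 : ∑ t ∈ PB.powerset, (∏ q ∈ t, a q / q) * L = (∏ q ∈ PB, (1 + a q / q)) * L := by
    rw [← Finset.sum_mul, Finset.prod_one_add]
  have step4 : ∏ q ∈ PB, (1 + a q / q) ≤ Real.exp (2 ^ (k + 1)) := by
    have hq2 : ∀ q ∈ PB, (2 : ℕ) ≤ q := fun q hq => (Finset.mem_filter.mp hq).2.two_le
    have h1 : ∏ q ∈ PB, (1 + a q / q) ≤ ∏ q ∈ PB, Real.exp (a q / q) := by
      refine Finset.prod_le_prod (fun q hq => ?_) fun q hq => ?_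
      · have := ha0 q (Finset.mem_filter.mp hq).2
        positivity
      · have := Real.add_one_le_exp (a q / q)
        linarith
    refine h1.trans ?_
    rw [← Real.exp_sum]
    refine Real.exp_le_exp.mpr ?_
    -- `Σ_{q∈PB} a(q)/q ≤ 2^{k+1} Σ_{q∈PB} q⁻² ≤ 2^{k+1}`
    have h2 : ∑ q ∈ PB, a q / q ≤ ∑ q ∈ PB, (2 : ℝ) ^ (k + 1) * ((q : ℝ) ^ 2)⁻¹ := by
      refine Finset.sum_le_sum fun q hq => ?_
      have hq := hq2 q hq
      have hqr : (0 : ℝ) < q := by exact_mod_cast lt_of_lt_of_le (by norm_num) hq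
      have hb := (ratio_pow_sub_one_bounds k hq).2
      calc a q / q ≤ (2 ^ (k + 1) / q) / q := by gcongr
        _ = 2 ^ (k + 1) * ((q : ℝ) ^ 2)⁻¹ := by field_simp
    refine h2.trans ?_
    rw [← Finset.mul_sum]
    have h3 : ∑ q ∈ PB, ((q : ℝ) ^ 2)⁻¹ ≤ 1 := by
      have hsub : PB ⊆ Finset.Ioo 1 (X + 1) := by
        intro q hq
        rw [hPB, Finset.mem_filter, Finset.mem_Icc] at hq
        rw [Finset.mem_Ioo]
        exact ⟨hq.2.one_lt, Nat.lt_succ_of_le hq.1.2⟩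
      calc ∑ q ∈ PB, ((q : ℝ) ^ 2)⁻¹ ≤ ∑ q ∈ Finset.Ioo 1 (X + 1), ((q : ℝ) ^ 2)⁻¹ :=
            Finset.sum_le_sum_of_subset_of_nonneg hsub fun q _ _ => by positivity
        _ ≤ 2 / (((1 : ℕ) : ℝ) + 1) := sum_Ioo_inv_sq_le 1 (X + 1)
        _ = 1 := by norm_num
    calc (2 : ℝ) ^ (k + 1) * ∑ q ∈ PB, ((q : ℝ) ^ 2)⁻¹ ≤ 2 ^ (k + 1) * 1 := by gcongr
      _ = 2 ^ (k + 1) := mul_one _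
  -- assemble
  rw [step1, step2]
  calc ∑ t ∈ PB.powerset, ∑ n ∈ (Finset.Ioc Y X).filter (fun n => t ⊆ n.primeFactors),
          (∏ q ∈ t, a q) / n
      ≤ ∑ t ∈ PB.powerset, (∏ q ∈ t, a q / q) * L := Finset.sum_le_sum inner
    _ = (∏ q ∈ PB, (1 + a q / q)) * L := step3
    _ ≤ Real.exp (2 ^ (k + 1)) * L := by gcongr

/-! ## Re-indexing a `(d,r)`-box sum by `n = dr` -/

/-- **`Σ_{d<N}Σ_{r<N} [p(dr)] F(d,r) = Σ_{n<N, p(n)} Σ_{r∣n} F(n/r, r)`** whenever `p(n)` forces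
`n < N` (so that the box truncation is vacuous): the substitution `n = dr` of §§8, 10 ("It follows,
by substituting `n = dr`, …", §8 p. 48). [cite: Zhang2022LandauSiegel, §8 p. 48] -/
theorem sum_box_ite_eq_sum_divisors {M : Type*} [AddCommMonoid M] (N : ℕ) (p : ℕ → Prop)
    [DecidablePred p] (hp : ∀ n, p n → n < N) (F : ℕ → ℕ → M) :
    ∑ d ∈ Finset.Ico 1 N, ∑ r ∈ Finset.Ico 1 N, (if p (d * r) then F d r else 0) =
      ∑ n ∈ (Finset.Ico 1 N).filter p, ∑ r ∈ n.divisors, F (n / r) r := by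
  classical
  rw [← Finset.sum_product', ← Finset.sum_filter, Finset.sum_sigma']
  refine Finset.sum_bij' (fun x _ => ⟨x.1 * x.2, x.2⟩) (fun y _ => (y.1 / y.2, y.2))
    ?_ ?_ ?_ ?_ ?_
  · -- `i` maps into the target
    rintro ⟨d, r⟩ hx
    simp only [Finset.mem_filter, Finset.mem_product, Finset.mem_Ico] at hx
    obtain ⟨⟨⟨hd1, -⟩, ⟨hr1, -⟩⟩, hpdr⟩ := hx
    simp only [Finset.mem_sigma, Finset.mem_filter, Finset.mem_Ico, Nat.mem_divisors]
    refine ⟨⟨⟨Nat.one_le_iff_ne_zero.mpr (mul_ne_zero (by omega) (by omega)), hp _ hpdr⟩, hpdr⟩,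
      dvd_mul_left r d, mul_ne_zero (by omega) (by omega)⟩
  · -- `j` maps into the source
    rintro ⟨n, r⟩ hy
    simp only [Finset.mem_sigma, Finset.mem_filter, Finset.mem_Ico, Nat.mem_divisors] at hy
    obtain ⟨⟨⟨hn1, hnN⟩, hpn⟩, hrn, hn0⟩ := hy
    have hr0 : 0 < r := Nat.pos_of_dvd_of_pos hrn (by omega)
    have hrn' : r ≤ n := Nat.le_of_dvd (by omega) hrn
    have hdiv : n / r * r = n := Nat.div_mul_cancel hrn
    simp only [Finset.mem_filter, Finset.mem_product, Finset.mem_Ico]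
    refine ⟨⟨⟨?_, lt_of_le_of_lt (Nat.div_le_self n r) hnN⟩, ⟨hr0, lt_of_le_of_lt hrn' hnN⟩⟩, ?_⟩
    · exact Nat.div_pos hrn' hr0
    · rw [hdiv]; exact hpn
  · -- `j ∘ i = id`
    rintro ⟨d, r⟩ hx
    simp only [Finset.mem_filter, Finset.mem_product, Finset.mem_Ico] at hx
    have hr0 : 0 < r := by omega
    simp [Nat.mul_div_cancel d hr0]
  · -- `i ∘ j = id`
    rintro ⟨n, r⟩ hy
    simp only [Finset.mem_sigma, Finset.mem_filter, Finset.mem_Ico, Nat.mem_divisors] at hy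
    obtain ⟨-, hrn, -⟩ := hy
    simp [Nat.div_mul_cancel hrn]
  · -- values agree
    rintro ⟨d, r⟩ hx
    simp only [Finset.mem_filter, Finset.mem_product, Finset.mem_Ico] at hx
    have hr0 : 0 < r := by omega
    simp [Nat.mul_div_cancel d hr0]

/-- For a real (quadratic) character, `|χ(d)|·|μ(r)χ(r)| = |χ(dr)|` for squarefree `r` and `= 0`
otherwise. [cite: Zhang2022LandauSiegel, §10 p. 57] -/
theorem norm_chi_mul_norm_moebius_chi {D : ℕ} (χ : DirichletCharacter ℂ D) (d r : ℕ) :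
    (‖χ (d : ZMod D)‖ : ℂ) * (‖((ArithmeticFunction.moebius r : ℤ) : ℂ) * χ (r : ZMod D)‖ : ℂ) =
      if Squarefree r then ((‖χ ((d * r : ℕ) : ZMod D)‖ : ℝ) : ℂ) else 0 := by
  split_ifs with hr
  · rw [norm_mul, Complex.norm_intCast, ArithmeticFunction.moebius_apply_of_squarefree hr]
    push_cast
    rw [abs_pow, abs_neg, abs_one, one_pow, map_mul, norm_mul]
    push_cast
    ring
  · rw [ArithmeticFunction.moebius_eq_zero_of_not_squarefree hr]
    simp

/-! ## The abstract range assembly: two approximate factors against the `(d,r)`-weights -/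

/-- **Abstract range assembly** (the pattern of every "the sum over `P^a ≤ dr < P^b` is equal to …
`+ o(α)`" display of §10, and of (8.11)-type steps): after the substitution `n = dr`, a `(d,r)`-sum
`Σ_n Σ_{r∣n, r sqfree} a(n)φ(r)⁻¹ M(n) N(n/r, r)` in which, for the "main" `n`, the second factor is
`c₀Π(n/r,r)G(n)` (`Π = Pw`) up to `e_N` and, for the remaining ("window") `n`, it is merely `≤ e_W`, while
`M = M₀ + O(e_M)` with `|M₀| ≤ B_M`, `|G| ≤ B_G`, differs from the collapsed main term
`Σ_n a(n)(n/φ(n))M₀(n)c₀G(n)` (collapse by (8.10): `Σ_{r∣n sqfree}Π(n/r,r)/φ(r) = n/φ(n)`) by at most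
`Σ_{main} |a(n)|(n/φ(n))((B_M+e_M)e_N + e_M|c₀|B_G) + Σ_{window} |a(n)|(n/φ(n))((B_M+e_M)e_W + B_M|c₀|B_G)`.
Pure finite-sum bookkeeping. [cite: Zhang2022LandauSiegel, §10 p. 57] -/
theorem range_assembly_bound {S : Finset ℕ} (hS : ∀ n ∈ S, n ≠ 0) (main : ℕ → Prop)
    [DecidablePred main] (a M M₀ G : ℕ → ℂ) (N Pw : ℕ → ℕ → ℂ) (c₀ : ℂ)
    {eM BM BG eN eW : ℝ} (heM : 0 ≤ eM) (hBM : 0 ≤ BM)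
    (hPi : ∀ n ∈ S, main n →
      ∑ r ∈ n.divisors with Squarefree r, (1 / (Nat.totient r : ℂ)) * Pw (n / r) r =
        (n : ℂ) / (Nat.totient n : ℂ))
    (hM : ∀ n ∈ S, ‖M n - M₀ n‖ ≤ eM) (hM₀ : ∀ n ∈ S, ‖M₀ n‖ ≤ BM) (hG : ∀ n ∈ S, ‖G n‖ ≤ BG)
    (hN : ∀ n ∈ S, main n → ∀ r ∈ n.divisors, Squarefree r →
      ‖N (n / r) r - c₀ * Pw (n / r) r * G n‖ ≤ eN)
    (hW : ∀ n ∈ S, ¬ main n → ∀ r ∈ n.divisors, Squarefree r → ‖N (n / r) r‖ ≤ eW) :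
    ‖(∑ n ∈ S, ∑ r ∈ n.divisors,
        (if Squarefree r then a n / (Nat.totient r : ℂ) * M n * N (n / r) r else 0)) -
      ∑ n ∈ S, a n * ((n : ℂ) / (Nat.totient n : ℂ)) * (M₀ n * c₀ * G n)‖ ≤
      (∑ n ∈ S.filter main, ‖a n‖ * ((n : ℝ) / Nat.totient n)) *
          ((BM + eM) * eN + eM * ‖c₀‖ * BG) +
        (∑ n ∈ S.filter (fun n => ¬ main n), ‖a n‖ * ((n : ℝ) / Nat.totient n)) *
          ((BM + eM) * eW + BM * ‖c₀‖ * BG) := by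
  classical
  -- per-`n` terms
  set L : ℕ → ℂ := fun n => ∑ r ∈ n.divisors,
    (if Squarefree r then a n / (Nat.totient r : ℂ) * M n * N (n / r) r else 0) with hL
  set R : ℕ → ℂ := fun n => a n * ((n : ℂ) / (Nat.totient n : ℂ)) * (M₀ n * c₀ * G n) with hR
  have hMle : ∀ n ∈ S, ‖M n‖ ≤ BM + eM := by
    intro n hn
    have := norm_le_norm_add_norm_sub' (M n) (M₀ n)
    -- ‖M‖ ≤ ‖M₀‖ + ‖M − M₀‖
    have h2 : ‖M n‖ ≤ ‖M₀ n‖ + ‖M n - M₀ n‖ := norm_le_norm_add_norm_sub' (M n) (M₀ n)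
    linarith [hM n hn, hM₀ n hn]
  -- the weight sum over squarefree divisors
  have hφsum : ∀ n ∈ S, ∑ r ∈ n.divisors with Squarefree r, (1 / (Nat.totient r : ℝ)) =
      (n : ℝ) / Nat.totient n := fun n hn => sum_sqfree_divisors_inv_totient (hS n hn)
  have hφpos : ∀ r : ℕ, r ≠ 0 → (0 : ℝ) < Nat.totient r := fun r hr => by
    exact_mod_cast Nat.totient_pos.mpr (Nat.pos_of_ne_zero hr)
  -- rewrite `L n` as `a n * M n * Σ_{r sqfree} N(n/r,r)/φ(r)`
  have hLeq : ∀ n ∈ S, L n = a n * M n *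
      ∑ r ∈ n.divisors with Squarefree r, N (n / r) r / (Nat.totient r : ℂ) := by
    intro n hn
    rw [hL]
    simp only
    rw [Finset.sum_filter, Finset.mul_sum]
    refine Finset.sum_congr rfl fun r _ => ?_
    split_ifs
    · ring
    · simp
  -- MAIN `n`
  have main_bound : ∀ n ∈ S, main n →
      ‖L n - R n‖ ≤ ‖a n‖ * ((n : ℝ) / Nat.totient n) * ((BM + eM) * eN + eM * ‖c₀‖ * BG) := by
    intro n hn hmain
    -- split `N = c₀ΠG + (N − c₀ΠG)`
    set Err : ℂ := ∑ r ∈ n.divisors with Squarefree r,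
      (N (n / r) r - c₀ * Pw (n / r) r * G n) / (Nat.totient r : ℂ) with hErr
    have hsplit : ∑ r ∈ n.divisors with Squarefree r, N (n / r) r / (Nat.totient r : ℂ) =
        c₀ * G n * ((n : ℂ) / (Nat.totient n : ℂ)) + Err := by
      rw [← hPi n hn hmain, hErr, Finset.mul_sum, ← Finset.sum_add_distrib]
      refine Finset.sum_congr rfl fun r _ => ?_
      ring
    have hErr_le : ‖Err‖ ≤ eN * ((n : ℝ) / Nat.totient n) := by
      rw [hErr, ← hφsum n hn, Finset.mul_sum]
      refine (norm_sum_le _ _).trans (Finset.sum_le_sum fun r hr => ?_)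
      have hr := Finset.mem_filter.mp hr
      have hr0 : r ≠ 0 := Nat.pos_iff_ne_zero.mp (Nat.pos_of_mem_divisors hr.1)
      rw [norm_div, Complex.norm_natCast, div_eq_mul_one_div]
      exact mul_le_mul_of_nonneg_right (hN n hn hmain r hr.1 hr.2) (by
        have := hφpos r hr0; positivity)
    have hdiff : L n - R n =
        a n * (M n - M₀ n) * (c₀ * G n) * ((n : ℂ) / (Nat.totient n : ℂ)) + a n * M n * Err := by
      rw [hLeq n hn, hsplit, hR]
      ring
    rw [hdiff]
    have hnφ : 0 ≤ (n : ℝ) / Nat.totient n := by positivity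
    have hnφC : ‖((n : ℂ) / (Nat.totient n : ℂ))‖ = (n : ℝ) / Nat.totient n := by
      rw [norm_div, Complex.norm_natCast, Complex.norm_natCast]
    refine (norm_add_le _ _).trans ?_
    rw [norm_mul, norm_mul, norm_mul, norm_mul, norm_mul, norm_mul, hnφC]
    have t1 : ‖a n‖ * ‖M n - M₀ n‖ * (‖c₀‖ * ‖G n‖) * ((n : ℝ) / Nat.totient n) ≤
        ‖a n‖ * eM * (‖c₀‖ * BG) * ((n : ℝ) / Nat.totient n) := by
      gcongr
      · exact hM n hn
      · exact hG n hn
    have t2 : ‖a n‖ * ‖M n‖ * ‖Err‖ ≤ ‖a n‖ * (BM + eM) * (eN * ((n : ℝ) / Nat.totient n)) := by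
      gcongr
      · exact hMle n hn
    calc ‖a n‖ * ‖M n - M₀ n‖ * (‖c₀‖ * ‖G n‖) * ((n : ℝ) / ↑n.totient) + ‖a n‖ * ‖M n‖ * ‖Err‖
        ≤ ‖a n‖ * eM * (‖c₀‖ * BG) * ((n : ℝ) / Nat.totient n) +
          ‖a n‖ * (BM + eM) * (eN * ((n : ℝ) / Nat.totient n)) := add_le_add t1 t2
      _ = ‖a n‖ * ((n : ℝ) / Nat.totient n) * ((BM + eM) * eN + eM * ‖c₀‖ * BG) := by ring
  -- WINDOW `n`
  have win_bound : ∀ n ∈ S, ¬ main n →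
      ‖L n - R n‖ ≤ ‖a n‖ * ((n : ℝ) / Nat.totient n) * ((BM + eM) * eW + BM * ‖c₀‖ * BG) := by
    intro n hn hwin
    have hnφC : ‖((n : ℂ) / (Nat.totient n : ℂ))‖ = (n : ℝ) / Nat.totient n := by
      rw [norm_div, Complex.norm_natCast, Complex.norm_natCast]
    have hsumN : ‖∑ r ∈ n.divisors with Squarefree r, N (n / r) r / (Nat.totient r : ℂ)‖ ≤
        eW * ((n : ℝ) / Nat.totient n) := by
      rw [← hφsum n hn, Finset.mul_sum]
      refine (norm_sum_le _ _).trans (Finset.sum_le_sum fun r hr => ?_)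
      have hr := Finset.mem_filter.mp hr
      have hr0 : r ≠ 0 := Nat.pos_iff_ne_zero.mp (Nat.pos_of_mem_divisors hr.1)
      rw [norm_div, Complex.norm_natCast, div_eq_mul_one_div]
      exact mul_le_mul_of_nonneg_right (hW n hn hwin r hr.1 hr.2) (by
        have := hφpos r hr0; positivity)
    have hL' : ‖L n‖ ≤ ‖a n‖ * (BM + eM) * (eW * ((n : ℝ) / Nat.totient n)) := by
      rw [hLeq n hn, norm_mul, norm_mul]
      gcongr
      · exact hMle n hn
    have hR' : ‖R n‖ ≤ ‖a n‖ * ((n : ℝ) / Nat.totient n) * (BM * ‖c₀‖ * BG) := by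
      rw [hR]
      simp only
      rw [norm_mul, norm_mul, norm_mul, norm_mul, hnφC]
      gcongr
      · exact hM₀ n hn
      · exact hG n hn
    calc ‖L n - R n‖ ≤ ‖L n‖ + ‖R n‖ := norm_sub_le _ _
      _ ≤ ‖a n‖ * (BM + eM) * (eW * ((n : ℝ) / Nat.totient n)) +
          ‖a n‖ * ((n : ℝ) / Nat.totient n) * (BM * ‖c₀‖ * BG) := add_le_add hL' hR'
      _ = ‖a n‖ * ((n : ℝ) / Nat.totient n) * ((BM + eM) * eW + BM * ‖c₀‖ * BG) := by ring
  -- sum up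
  have htot : (∑ n ∈ S, L n) - ∑ n ∈ S, R n = ∑ n ∈ S, (L n - R n) := by
    rw [Finset.sum_sub_distrib]
  rw [htot]
  refine (norm_sum_le _ _).trans ?_
  rw [← Finset.sum_filter_add_sum_filter_not S main, Finset.sum_mul, Finset.sum_mul]
  refine add_le_add (Finset.sum_le_sum fun n hn => ?_) (Finset.sum_le_sum fun n hn => ?_)
  · have h := Finset.mem_filter.mp hn
    exact main_bound n h.1 h.2
  · have h := Finset.mem_filter.mp hn
    exact win_bound n h.1 h.2

/-- **Abstract range assembly, window variant** (for ranges whose window carries no main term in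
EITHER factor, e.g. the top range `P^{0.502} ≤ dr < P^{0.504}` of §10, where Lemma 8.2 does not reach
`x = P₁/n ≤ T`): as `range_assembly_bound`, but on the window `n` only crude bounds are assumed —
`|M(n)| ≤ B_W` and `|N(n/r,r)| ≤ e_W·(n/φ(n))²` (the latter covers both the `O(𝓛⁻⁷)` windows of
Lemma 10.2 and a boundary point where only the main-term form `|c₀Π(d,r)G| + O(𝓛⁻¹⁵)`,
`|Π(d,r)| ≤ (n/φ(n))²`, is available) — and `M = M₀ + O(e_M)` is required on the main `n` only. The
window contribution is then weighted by `|a(n)|(n/φ(n))³`. Pure finite-sum bookkeeping.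
[cite: Zhang2022LandauSiegel, §10 p. 57] -/
theorem range_assembly_bound₂ {S : Finset ℕ} (hS : ∀ n ∈ S, n ≠ 0) (main : ℕ → Prop)
    [DecidablePred main] (a M M₀ G : ℕ → ℂ) (N Pw : ℕ → ℕ → ℂ) (c₀ : ℂ)
    {eM BM BW BG eN eW : ℝ} (heM : 0 ≤ eM) (hBM : 0 ≤ BM) (hBW : 0 ≤ BW)
    (hPi : ∀ n ∈ S, main n →
      ∑ r ∈ n.divisors with Squarefree r, (1 / (Nat.totient r : ℂ)) * Pw (n / r) r =
        (n : ℂ) / (Nat.totient n : ℂ))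
    (hM : ∀ n ∈ S, main n → ‖M n - M₀ n‖ ≤ eM) (hM₀ : ∀ n ∈ S, ‖M₀ n‖ ≤ BM)
    (hMW : ∀ n ∈ S, ¬ main n → ‖M n‖ ≤ BW) (hG : ∀ n ∈ S, ‖G n‖ ≤ BG)
    (hN : ∀ n ∈ S, main n → ∀ r ∈ n.divisors, Squarefree r →
      ‖N (n / r) r - c₀ * Pw (n / r) r * G n‖ ≤ eN)
    (hW : ∀ n ∈ S, ¬ main n → ∀ r ∈ n.divisors, Squarefree r →
      ‖N (n / r) r‖ ≤ eW * ((n : ℝ) / Nat.totient n) ^ 2) :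
    ‖(∑ n ∈ S, ∑ r ∈ n.divisors,
        (if Squarefree r then a n / (Nat.totient r : ℂ) * M n * N (n / r) r else 0)) -
      ∑ n ∈ S, a n * ((n : ℂ) / (Nat.totient n : ℂ)) * (M₀ n * c₀ * G n)‖ ≤
      (∑ n ∈ S.filter main, ‖a n‖ * ((n : ℝ) / Nat.totient n)) *
          ((BM + eM) * eN + eM * ‖c₀‖ * BG) +
        (∑ n ∈ S.filter (fun n => ¬ main n), ‖a n‖ * ((n : ℝ) / Nat.totient n) ^ 3) *
          (BW * eW + BM * ‖c₀‖ * BG) := by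
  classical
  set L : ℕ → ℂ := fun n => ∑ r ∈ n.divisors,
    (if Squarefree r then a n / (Nat.totient r : ℂ) * M n * N (n / r) r else 0) with hL
  set R : ℕ → ℂ := fun n => a n * ((n : ℂ) / (Nat.totient n : ℂ)) * (M₀ n * c₀ * G n) with hR
  have hBG : ∀ n ∈ S, 0 ≤ BG := fun n hn => (norm_nonneg _).trans (hG n hn)
  have hφsum : ∀ n ∈ S, ∑ r ∈ n.divisors with Squarefree r, (1 / (Nat.totient r : ℝ)) =
      (n : ℝ) / Nat.totient n := fun n hn => sum_sqfree_divisors_inv_totient (hS n hn)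
  have hφpos : ∀ r : ℕ, r ≠ 0 → (0 : ℝ) < Nat.totient r := fun r hr => by
    exact_mod_cast Nat.totient_pos.mpr (Nat.pos_of_ne_zero hr)
  have hratio1 : ∀ n ∈ S, 1 ≤ (n : ℝ) / Nat.totient n := fun n hn => one_le_self_div_totient (hS n hn)
  have hLeq : ∀ n ∈ S, L n = a n * M n *
      ∑ r ∈ n.divisors with Squarefree r, N (n / r) r / (Nat.totient r : ℂ) := by
    intro n hn
    rw [hL]
    simp only
    rw [Finset.sum_filter, Finset.mul_sum]
    refine Finset.sum_congr rfl fun r _ => ?_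
    split_ifs
    · ring
    · simp
  -- MAIN `n`: identical to `range_assembly_bound`
  have main_bound : ∀ n ∈ S, main n →
      ‖L n - R n‖ ≤ ‖a n‖ * ((n : ℝ) / Nat.totient n) * ((BM + eM) * eN + eM * ‖c₀‖ * BG) := by
    intro n hn hmain
    have hMle : ‖M n‖ ≤ BM + eM := by
      have h2 : ‖M n‖ ≤ ‖M₀ n‖ + ‖M n - M₀ n‖ := norm_le_norm_add_norm_sub' (M n) (M₀ n)
      linarith [hM n hn hmain, hM₀ n hn]
    set Err : ℂ := ∑ r ∈ n.divisors with Squarefree r,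
      (N (n / r) r - c₀ * Pw (n / r) r * G n) / (Nat.totient r : ℂ) with hErr
    have hsplit : ∑ r ∈ n.divisors with Squarefree r, N (n / r) r / (Nat.totient r : ℂ) =
        c₀ * G n * ((n : ℂ) / (Nat.totient n : ℂ)) + Err := by
      rw [← hPi n hn hmain, hErr, Finset.mul_sum, ← Finset.sum_add_distrib]
      refine Finset.sum_congr rfl fun r _ => ?_
      ring
    have hErr_le : ‖Err‖ ≤ eN * ((n : ℝ) / Nat.totient n) := by
      rw [hErr, ← hφsum n hn, Finset.mul_sum]
      refine (norm_sum_le _ _).trans (Finset.sum_le_sum fun r hr => ?_)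
      have hr := Finset.mem_filter.mp hr
      have hr0 : r ≠ 0 := Nat.pos_iff_ne_zero.mp (Nat.pos_of_mem_divisors hr.1)
      rw [norm_div, Complex.norm_natCast, div_eq_mul_one_div]
      exact mul_le_mul_of_nonneg_right (hN n hn hmain r hr.1 hr.2) (by
        have := hφpos r hr0; positivity)
    have hdiff : L n - R n =
        a n * (M n - M₀ n) * (c₀ * G n) * ((n : ℂ) / (Nat.totient n : ℂ)) + a n * M n * Err := by
      rw [hLeq n hn, hsplit, hR]
      ring
    rw [hdiff]
    have hnφC : ‖((n : ℂ) / (Nat.totient n : ℂ))‖ = (n : ℝ) / Nat.totient n := by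
      rw [norm_div, Complex.norm_natCast, Complex.norm_natCast]
    refine (norm_add_le _ _).trans ?_
    rw [norm_mul, norm_mul, norm_mul, norm_mul, norm_mul, norm_mul, hnφC]
    have t1 : ‖a n‖ * ‖M n - M₀ n‖ * (‖c₀‖ * ‖G n‖) * ((n : ℝ) / Nat.totient n) ≤
        ‖a n‖ * eM * (‖c₀‖ * BG) * ((n : ℝ) / Nat.totient n) := by
      gcongr
      · exact hM n hn hmain
      · exact hG n hn
    have t2 : ‖a n‖ * ‖M n‖ * ‖Err‖ ≤ ‖a n‖ * (BM + eM) * (eN * ((n : ℝ) / Nat.totient n)) := by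
      gcongr
    calc ‖a n‖ * ‖M n - M₀ n‖ * (‖c₀‖ * ‖G n‖) * ((n : ℝ) / ↑n.totient) + ‖a n‖ * ‖M n‖ * ‖Err‖
        ≤ ‖a n‖ * eM * (‖c₀‖ * BG) * ((n : ℝ) / Nat.totient n) +
          ‖a n‖ * (BM + eM) * (eN * ((n : ℝ) / Nat.totient n)) := add_le_add t1 t2
      _ = ‖a n‖ * ((n : ℝ) / Nat.totient n) * ((BM + eM) * eN + eM * ‖c₀‖ * BG) := by ring
  -- WINDOW `n`: crude bounds on both factors
  have win_bound : ∀ n ∈ S, ¬ main n →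
      ‖L n - R n‖ ≤ ‖a n‖ * ((n : ℝ) / Nat.totient n) ^ 3 * (BW * eW + BM * ‖c₀‖ * BG) := by
    intro n hn hwin
    have h1n := hratio1 n hn
    have hnφC : ‖((n : ℂ) / (Nat.totient n : ℂ))‖ = (n : ℝ) / Nat.totient n := by
      rw [norm_div, Complex.norm_natCast, Complex.norm_natCast]
    have hsumN : ‖∑ r ∈ n.divisors with Squarefree r, N (n / r) r / (Nat.totient r : ℂ)‖ ≤
        eW * ((n : ℝ) / Nat.totient n) ^ 2 * ((n : ℝ) / Nat.totient n) := by
      have step : ‖∑ r ∈ n.divisors with Squarefree r, N (n / r) r / (Nat.totient r : ℂ)‖ ≤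
          ∑ r ∈ n.divisors with Squarefree r,
            eW * ((n : ℝ) / Nat.totient n) ^ 2 * (1 / (Nat.totient r : ℝ)) := by
        refine (norm_sum_le _ _).trans (Finset.sum_le_sum fun r hr => ?_)
        have hr := Finset.mem_filter.mp hr
        have hr0 : r ≠ 0 := Nat.pos_iff_ne_zero.mp (Nat.pos_of_mem_divisors hr.1)
        rw [norm_div, Complex.norm_natCast, div_eq_mul_one_div]
        exact mul_le_mul_of_nonneg_right (hW n hn hwin r hr.1 hr.2) (by
          have := hφpos r hr0; positivity)
      rw [← Finset.mul_sum, hφsum n hn] at step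
      exact step
    have hL' : ‖L n‖ ≤ ‖a n‖ * BW * (eW * ((n : ℝ) / Nat.totient n) ^ 2 * ((n : ℝ) / Nat.totient n)) := by
      rw [hLeq n hn, norm_mul, norm_mul]
      gcongr
      · exact hMW n hn hwin
    have hR' : ‖R n‖ ≤ ‖a n‖ * ((n : ℝ) / Nat.totient n) * (BM * ‖c₀‖ * BG) := by
      rw [hR]
      simp only
      rw [norm_mul, norm_mul, norm_mul, norm_mul, hnφC]
      gcongr
      · exact hM₀ n hn
      · exact hG n hn
    have hR'' : ‖a n‖ * ((n : ℝ) / Nat.totient n) * (BM * ‖c₀‖ * BG) ≤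
        ‖a n‖ * ((n : ℝ) / Nat.totient n) ^ 3 * (BM * ‖c₀‖ * BG) := by
      have hpow : (n : ℝ) / Nat.totient n ≤ ((n : ℝ) / Nat.totient n) ^ 3 := by
        calc (n : ℝ) / Nat.totient n = ((n : ℝ) / Nat.totient n) ^ 1 := (pow_one _).symm
          _ ≤ ((n : ℝ) / Nat.totient n) ^ 3 := pow_le_pow_right₀ h1n (by norm_num)
      have hBG0 := hBG n hn
      gcongr
    calc ‖L n - R n‖ ≤ ‖L n‖ + ‖R n‖ := norm_sub_le _ _
      _ ≤ ‖a n‖ * BW * (eW * ((n : ℝ) / Nat.totient n) ^ 2 * ((n : ℝ) / Nat.totient n)) +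
          ‖a n‖ * ((n : ℝ) / Nat.totient n) ^ 3 * (BM * ‖c₀‖ * BG) := add_le_add hL' (hR'.trans hR'')
      _ = ‖a n‖ * ((n : ℝ) / Nat.totient n) ^ 3 * (BW * eW + BM * ‖c₀‖ * BG) := by ring
  -- sum up
  have htot : (∑ n ∈ S, L n) - ∑ n ∈ S, R n = ∑ n ∈ S, (L n - R n) := by
    rw [Finset.sum_sub_distrib]
  rw [htot]
  refine (norm_sum_le _ _).trans ?_
  rw [← Finset.sum_filter_add_sum_filter_not S main, Finset.sum_mul, Finset.sum_mul]
  refine add_le_add (Finset.sum_le_sum fun n hn => ?_) (Finset.sum_le_sum fun n hn => ?_)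
  · have h := Finset.mem_filter.mp hn
    exact main_bound n h.1 h.2
  · have h := Finset.mem_filter.mp hn
    exact win_bound n h.1 h.2

end Literature.NumberTheory.LFunctions.Zhang2022.Skeleton
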